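import Literature.NumberTheory.Automorphic.ClozelAlgebraicityPurityProofs
import Literature.NumberTheory.Automorphic.InfinityTypeAutomorphicInduction
import Literature.NumberTheory.Automorphic.ArchParameterUnique
import Literature.NumberTheory.NumberFields.CMDescentEmbeddings
import HarnessLib

/-!
# SoloBlindStrongPurity — automorphic inductions from a non-CM field are never regular

Solo seat `solo-Langlands-blind` (blind mode), session 3.  This file settles, negatively and inside
the tree, question (E?) of the seat's descent memo (paper/descent.md §5): *are there regular
algebraic cuspidal `π` on `GL_n` over a number field `L` that is neither totally real nor CM whose
automorphic induction to a totally real or CM subfield `K` is again regular?*  Such "AI-regular"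
forms are exactly what a descent of the Harris–Lan–Taylor–Thorne / Scholze Galois representations
from `K` to `L` along `AI_{L/K}` would consume.  They do not exist:

* `not_isRegular_automorphicInduction_of_two_embeddings` — bookkeeping: if two distinct
  embeddings `σ' ≠ σ''` of `L` over the same embedding of `K` carry the same (nonempty) multiset of
  `z`-exponents, the induced infinity type `T^{L/K}` (`InfinityType.automorphicInduction`, the type
  of `AI_{L/K}`, Henniart 2012) is not regular (an exponent is repeated in the fibre sum).
* `not_isRegular_automorphicInduction_of_stronglyPure` — the combinatorial core.  Call `T`
  *strongly pure of weight `w`* if for every `γ ∈ Aut(ℂ)` and every embedding `σ` the `a`-multiset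
  at the `γ`-twisted conjugate `γ⁻¹ ∘ c ∘ γ ∘ σ` is `{w - a}` of the `a`-multiset at `σ` (purity of
  ALL the `Aut(ℂ)`-conjugates `^γT`).  If complex conjugation commutes with `Aut(ℂ)` along every
  embedding of `K` ("`K` is totally real or CM", Patrikis 2019 §2) but NOT along some embedding of
  `L`, then `σ' = c ∘ σ` and `σ'' = γ⁻¹ c γ ∘ σ` are distinct, lie over the same embedding
  `c ∘ σ|_K` of `K`, and both carry `{w - a : a ∈ T σ}`: so `T^{L/K}` is irregular.
* `stronglyPure_of_clozel1990` — under the tree's vendored named fact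
  `Clozel1990_regularAlgebraic` (Clozel 1990, Thm. 3.13 + Lemme 4.9, as rendered in
  `ClozelAlgebraicity`: clause (ii) conjugates, clause (iii) purity), EVERY infinity type of a
  cuspidal regular algebraic `π` on `GL_n(𝔸_L)`, `n ≥ 1`, is strongly pure: apply purity to the
  conjugate `^γπ`, which is pure of the same weight
  (`Clozel1990_regularAlgebraic.exists_autConjugate_pure_same_weight`).  Only clauses (ii)+(iii)
  are used — no model of `π_f` over `ℚ(π_f)`, no strong multiplicity one (contrast the tree's
  `Patrikis2019_cmDescent_of_clozel`, which needs both and is stated for totally imaginary `F`).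
* `conj_comm_of_isTotallyReal_or_isCMField`, `exists_conj_not_comm_of_not_isTotallyReal_or_isCMField`
  — the two field-theoretic readings (Mathlib `IsTotallyReal`, `IsCMField`; the second is the
  tree's `isTotallyReal_or_isCMField_of_conj_comm_apply`, Patrikis 2019 §2).
* **`not_isRegular_automorphicInduction`** — the theorem: `Clozel1990_regularAlgebraic` ⇒ for
  `K` totally real or CM, `L ⊇ K` neither, `n ≥ 1`, `π` cuspidal regular algebraic on `GL_n(𝔸_L)`
  and `T` any infinity type of `π`, the induced type `T^{L/K}` of any rank is NOT regular.
* `not_isRegularAlgebraic_of_isAutomorphicInductionAlong` — with Henniart's fact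
  (`Henniart2012_infinityType_of_automorphicInduction`: `AI(π)_∞` has type `T_π^{L/K}`), for `L/K`
  cyclic: no cuspidal automorphic induction `P = AI_{L/K}(π)` of such a `π` is regular algebraic.

Prior art.  The statement is in print: Patrikis 2019 (Mem. AMS 258 = arXiv:1207.6724),
Remark 2.4.8 (arXiv Rem. 3.2.4), second bullet — "Let `F` be a CM field and `π` be a regular `L` or
`C`-algebraic cuspidal representation of `GL_n(𝔸_F)`.  Suppose that `π = Ind_L^F(π₀)` for some
extension `L/F`.  Then `L` is CM." — as a consequence of his CM descent of the infinity type,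
Prop. 2.4.7 (in the tree as the named fact `Patrikis2019_cmDescent`, stated for totally imaginary
fields and reduced there to Clozel's theorem plus a model clause and strong multiplicity one); for
cohomological weights see also Raghuram 2022 (arXiv:2207.03393) Prop. 2.6 ("strongly pure weights
are base-changed from `F₁`").  What is added here is a kernel-checked proof from the vendored
`Clozel1990_regularAlgebraic` alone, by the shortcut "purity of the conjugates ⇒ equal exponents at
`c∘σ` and `γ⁻¹cγ∘σ`" (the two-embedding shadow of the descent, which is all AI-irregularity needs),
valid for `L` of any signature and `K` totally real or CM.  Consequence recorded in the seat's
census: descent hypotheses of the form "`AI_{L/K}(π)` regular algebraic" are vacuous unless `L` is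
itself totally real or CM. [cite: Patrikis2019, Prop. 2.4.7 and Rem. 2.4.8 (arXiv:1207.6724 §3.2,
Prop. cmdescent, Rem. 3.2.4)] [cite: Clozel1990, Thm. 3.13 and Lemme 4.9]
-/

noncomputable section

open scoped ComplexConjugate Classical
open NumberField Literature.NumberTheory.Automorphic

namespace Summit.Langlands.Langlands.Theorems
namespace SoloBlind

/-! ### Bookkeeping: two embeddings in one fibre with the same exponents -/

section TwoEmbeddings

variable {K : Type*} [Field K] {L : Type*} [Field L] [Algebra K L] [Fintype (L →+* ℂ)] {n N : ℕ}

/-- If two distinct embeddings `σ' ≠ σ''` of `L` restrict to the same embedding of `K` and carry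
the same nonempty multiset of `z`-exponents, then the induced infinity type `T^{L/K}` is not
regular: the fibre sum over `σ'|_K` contains that multiset twice. -/
theorem not_isRegular_automorphicInduction_of_two_embeddings (T : InfinityType L n)
    {σ' σ'' : L →+* ℂ} (hne : σ' ≠ σ'')
    (hres : σ'.comp (algebraMap K L) = σ''.comp (algebraMap K L))
    (ha : (T σ').map ArchWeight.a = (T σ'').map ArchWeight.a) (h0 : T σ' ≠ 0) :
    ¬ (T.automorphicInduction K N).IsRegular := by
  intro hreg
  have hnd := (InfinityType.isRegular_automorphicInduction_iff T).mp hreg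
    (σ'.comp (algebraMap K L))
  have hsub : ({σ', σ''} : Finset (L →+* ℂ)) ⊆
      Finset.univ.filter
        (fun ρ : L →+* ℂ => ρ.comp (algebraMap K L) = σ'.comp (algebraMap K L)) := by
    intro ρ hρ
    simp only [Finset.mem_insert, Finset.mem_singleton] at hρ
    simp only [Finset.mem_filter, Finset.mem_univ, true_and]
    rcases hρ with rfl | rfl
    · rfl
    · exact hres.symm
  have hle : (T σ').map ArchWeight.a + (T σ'').map ArchWeight.a ≤
      ∑ ρ ∈ Finset.univ.filter
        (fun ρ : L →+* ℂ => ρ.comp (algebraMap K L) = σ'.comp (algebraMap K L)),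
        (T ρ).map ArchWeight.a := by
    have hpair : ∑ ρ ∈ ({σ', σ''} : Finset (L →+* ℂ)), (T ρ).map ArchWeight.a =
        (T σ').map ArchWeight.a + (T σ'').map ArchWeight.a := Finset.sum_pair hne
    have hle' := Finset.sum_le_sum_of_subset_of_nonneg (f := fun ρ : L →+* ℂ => (T ρ).map ArchWeight.a)
      hsub fun _ _ _ => Multiset.zero_le _
    rwa [hpair] at hle'
  have hnd2 : ((T σ').map ArchWeight.a + (T σ'').map ArchWeight.a).Nodup :=
    Multiset.nodup_of_le hle hnd
  rw [← ha] at hnd2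
  have hm0 : (T σ').map ArchWeight.a ≠ 0 := fun h => h0 (Multiset.map_eq_zero.mp h)
  obtain ⟨x, hx⟩ := Multiset.exists_mem_of_ne_zero hm0
  have hc := Multiset.nodup_iff_count_le_one.mp hnd2 x
  rw [Multiset.count_add] at hc
  have h1 : 1 ≤ Multiset.count x ((T σ').map ArchWeight.a) :=
    Multiset.one_le_count_iff_mem.mpr hx
  omega

/-! ### The combinatorial core: strong purity + a twisted conjugation not acting as `c` on `L` -/

/-- **Strong purity forces irregular inductions towards conjugation-stable subfields.**  Let
`T : InfinityType L n` be nonzero at every embedding and *strongly pure of weight `w`*: for all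
`γ ∈ Aut(ℂ) = (ℂ ≃ₐ[ℚ] ℂ)` and all `σ : L → ℂ`, the `a`-multiset of `T` at the twisted conjugate
`γ⁻¹ ∘ c ∘ γ ∘ σ` is `{w - a : a ∈ a-multiset at σ}`.  Suppose complex conjugation commutes with
every automorphism of `ℂ` along every embedding of `K` (so `γ⁻¹cγ` and `c` agree on
`K`-embeddings), but along some embedding `σ` of `L` some `γ` fails to commute.  Then `c ∘ σ` and
`γ⁻¹ ∘ c ∘ γ ∘ σ` are two distinct embeddings over the same embedding of `K` with the same
exponents, and `T^{L/K}` is not regular. -/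
theorem not_isRegular_automorphicInduction_of_stronglyPure (T : InfinityType L n) (w : ℂ)
    (hT : ∀ (γ : ℂ ≃ₐ[ℚ] ℂ) (σ : L →+* ℂ),
      (T ((γ.symm : ℂ ≃ₐ[ℚ] ℂ).toAlgHom.toRingHom.comp
        ((starRingEnd ℂ).comp ((γ : ℂ ≃ₐ[ℚ] ℂ).toAlgHom.toRingHom.comp σ)))).map ArchWeight.a =
        ((T σ).map ArchWeight.a).map fun a => w - a)
    (h0 : ∀ σ, T σ ≠ 0)
    (hK : ∀ (γ : ℂ ≃ₐ[ℚ] ℂ) (τ : K →+* ℂ) (x : K), γ (conj (τ x)) = conj (γ (τ x)))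
    (hL : ∃ (γ : ℂ ≃ₐ[ℚ] ℂ) (σ : L →+* ℂ) (x : L), γ (conj (σ x)) ≠ conj (γ (σ x))) :
    ¬ (T.automorphicInduction K N).IsRegular := by
  obtain ⟨γ, σ, x, hx⟩ := hL
  -- the two embeddings `σ' = c ∘ σ` and `σ'' = γ⁻¹ ∘ c ∘ γ ∘ σ`
  set σ' : L →+* ℂ := (starRingEnd ℂ).comp σ with hσ'
  set σ'' : L →+* ℂ := (γ.symm : ℂ ≃ₐ[ℚ] ℂ).toAlgHom.toRingHom.comp
    ((starRingEnd ℂ).comp ((γ : ℂ ≃ₐ[ℚ] ℂ).toAlgHom.toRingHom.comp σ)) with hσ''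
  refine not_isRegular_automorphicInduction_of_two_embeddings T (σ' := σ') (σ'' := σ'')
    ?_ ?_ ?_ (h0 σ')
  · -- distinct: they differ at `x`
    intro h
    have hx' : conj (σ x) = γ.symm (conj (γ (σ x))) := RingHom.congr_fun h x
    apply hx
    rw [hx', AlgEquiv.apply_symm_apply]
  · -- same restriction to `K`: conjugation commutes with `γ` along `σ|_K`
    refine RingHom.ext fun y => ?_
    have hk := hK γ (σ.comp (algebraMap K L)) y
    simp only [RingHom.comp_apply] at hk
    change conj (σ (algebraMap K L y)) = γ.symm (conj (γ (σ (algebraMap K L y))))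
    rw [← hk, AlgEquiv.symm_apply_apply]
  · -- same exponents: both are `{w - a : a ∈ T σ}` (strong purity at `γ = 1` and at `γ`)
    have h1 := hT 1 σ
    have h2 := hT γ σ
    have e : ((1 : ℂ ≃ₐ[ℚ] ℂ).symm : ℂ ≃ₐ[ℚ] ℂ).toAlgHom.toRingHom.comp
        ((starRingEnd ℂ).comp ((1 : ℂ ≃ₐ[ℚ] ℂ).toAlgHom.toRingHom.comp σ)) = σ' :=
      RingHom.ext fun _ => rfl
    rw [e] at h1
    exact h1.trans h2.symm

end TwoEmbeddings

/-! ### Strong purity from Clozel's theorem (clauses (ii) + (iii) of the vendored fact) -/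

section Clozel

variable {L : Type} [Field L] [NumberField L] {n : ℕ} {hcpt : isCompact_glFiniteIntegralLevel n L}

/-- **Every infinity type of a cuspidal regular algebraic `π` is strongly pure** (granted
`Clozel1990_regularAlgebraic`; `n ≥ 1`).  For `γ ∈ Aut(ℂ)` the conjugate `^γπ` (clause (ii)) is
cuspidal regular algebraic with the `a`-multisets of `^γT`, and pure of the SAME weight `w`
(clause (iii) for `^γπ`, `exists_autConjugate_pure_same_weight`); purity of `^γT` at the
embedding `γ ∘ σ` reads `{a at γ⁻¹cγσ} = {w - a : a at σ}` for `T`.  The statement is about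
`a`-multisets only, so it transfers from a regular algebraic infinity type of `π` to any infinity
type `T` of `π` (`hasArchParameter_unique`). -/
theorem stronglyPure_of_clozel1990 (h : Clozel1990_regularAlgebraic) (hn : n ≠ 0)
    (π : CuspidalAutomorphicRepData n L hcpt) (hπ : π.1.IsRegularAlgebraic)
    {T : InfinityType L n} (hT : π.1.HasInfinityType T) :
    ∃ w : ℤ, ∀ (γ : ℂ ≃ₐ[ℚ] ℂ) (σ : L →+* ℂ),
      (T ((γ.symm : ℂ ≃ₐ[ℚ] ℂ).toAlgHom.toRingHom.comp
        ((starRingEnd ℂ).comp ((γ : ℂ ≃ₐ[ℚ] ℂ).toAlgHom.toRingHom.comp σ)))).map ArchWeight.a =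
        ((T σ).map ArchWeight.a).map fun a => (w : ℂ) - a := by
  obtain ⟨T₀, hT₀, hreg₀⟩ := hπ
  obtain ⟨w, hw⟩ := h.purity π hT₀ hreg₀
  refine ⟨w, fun γ σ => ?_⟩
  obtain ⟨π', T', -, hT'π, -, ha, hw'⟩ :=
    h.exists_autConjugate_pure_same_weight hn π hT₀ hreg₀ hw γ
  have eT : ∀ ρ : L →+* ℂ, (T₀ ρ).map ArchWeight.a = (T ρ).map ArchWeight.a := fun ρ =>
    congr_fun (π.1.hasArchParameter_unique hT₀.2 hT.2) ρ
  have key := hw' ((γ : ℂ ≃ₐ[ℚ] ℂ).toAlgHom.toRingHom.comp σ)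
  rw [ha, ha] at key
  simp only [InfinityType.autConj_apply] at key
  have e1 : ((γ.symm : ℂ ≃ₐ[ℚ] ℂ)).toAlgHom.toRingHom.comp
      ((γ : ℂ ≃ₐ[ℚ] ℂ).toAlgHom.toRingHom.comp σ) = σ :=
    RingHom.ext fun y => γ.symm_apply_apply (σ y)
  rw [e1, eT, eT] at key
  exact key

end Clozel

/-! ### The two field-theoretic readings -/

section Fields

/-- On a totally real or CM number field, complex conjugation commutes with every automorphism of
`ℂ` along every embedding (Patrikis 2019, §2: "the number fields on which complex conjugation is
well-defined"; Mathlib `IsTotallyReal.complexEmbedding_isReal`, `IsCMField.complexEmbedding_complexConj`). -/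
theorem conj_comm_of_isTotallyReal_or_isCMField {K : Type} [Field K] [NumberField K]
    (hK : IsTotallyReal K ∨ IsCMField K) (γ : ℂ ≃ₐ[ℚ] ℂ) (τ : K →+* ℂ) (x : K) :
    γ (conj (τ x)) = conj (γ (τ x)) := by
  rcases hK with h | h
  · haveI := h
    have h1 : conj (τ x) = τ x := RingHom.congr_fun
      (ComplexEmbedding.isReal_iff.mp (IsTotallyReal.complexEmbedding_isReal τ)) x
    have h2 : conj (γ (τ x)) = γ (τ x) := RingHom.congr_fun
      (ComplexEmbedding.isReal_iff.mp
        (IsTotallyReal.complexEmbedding_isReal ((γ : ℂ ≃ₐ[ℚ] ℂ).toAlgHom.toRingHom.comp τ))) x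
    rw [h1, h2]
  · haveI := h
    have h1 := IsCMField.complexEmbedding_complexConj K τ x
    have h2 := IsCMField.complexEmbedding_complexConj K
      ((γ : ℂ ≃ₐ[ℚ] ℂ).toAlgHom.toRingHom.comp τ) x
    simp only [RingHom.comp_apply] at h2
    change γ (τ (IsCMField.complexConj K x)) = conj (γ (τ x)) at h2
    rw [← h1, h2]

/-- A number field that is neither totally real nor CM has an embedding along which some
automorphism of `ℂ` does not commute with complex conjugation (contrapositive of the tree's
`isTotallyReal_or_isCMField_of_conj_comm_apply`, Patrikis 2019, §2). -/
theorem exists_conj_not_comm_of_not_isTotallyReal_or_isCMField {L : Type} [Field L] [NumberField L]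
    (hL : ¬ (IsTotallyReal L ∨ IsCMField L)) :
    ∃ (γ : ℂ ≃ₐ[ℚ] ℂ) (σ : L →+* ℂ) (x : L), γ (conj (σ x)) ≠ conj (γ (σ x)) := by
  by_contra hne
  push Not at hne
  obtain ⟨φ₀⟩ : Nonempty (L →+* ℂ) := inferInstance
  refine hL (Literature.NumberTheory.NumberFields.isTotallyReal_or_isCMField_of_conj_comm_apply φ₀
    fun σ x => ?_)
  exact hne (AlgEquiv.ofRingEquiv (f := σ) fun q => by simp) φ₀ x

end Fields

/-! ### The theorem -/

section Main

variable {K L : Type} [Field K] [NumberField K] [Field L] [NumberField L] [Algebra K L]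

/-- **Automorphic inductions of regular algebraic cusp forms from a non-CM field are never regular**
(granted Clozel's theorem `Clozel1990_regularAlgebraic`).  Let `K ⊆ L` be number fields with `K`
totally real or CM and `L` neither, `n ≥ 1`, `π` a cuspidal regular algebraic automorphic
representation of `GL_n(𝔸_L)` and `T` any infinity type of `π`.  Then the induced infinity type
`T^{L/K}` (the type of `AI_{L/K}(π)`, of any nominal rank `N`) is not regular. -/
theorem not_isRegular_automorphicInduction (h : Clozel1990_regularAlgebraic)
    (hK : IsTotallyReal K ∨ IsCMField K) (hL : ¬ (IsTotallyReal L ∨ IsCMField L))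
    {n N : ℕ} (hn : n ≠ 0) {hcpt : isCompact_glFiniteIntegralLevel n L}
    (π : CuspidalAutomorphicRepData n L hcpt) (hπ : π.1.IsRegularAlgebraic)
    {T : InfinityType L n} (hT : π.1.HasInfinityType T) :
    ¬ (T.automorphicInduction K N).IsRegular := by
  obtain ⟨w, hw⟩ := stronglyPure_of_clozel1990 h hn π hπ hT
  refine not_isRegular_automorphicInduction_of_stronglyPure T (w : ℂ) hw ?_
    (conj_comm_of_isTotallyReal_or_isCMField hK)
    (exists_conj_not_comm_of_not_isTotallyReal_or_isCMField hL)
  intro σ hz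
  have hc := hT.1.1 σ
  rw [hz, Multiset.card_zero] at hc
  exact hn hc.symm

/-- **No cuspidal automorphic induction from a non-CM field is regular algebraic** (granted Clozel's
theorem and Henniart's archimedean description of automorphic induction).  For `L/K` cyclic of
degree `d` with `K` totally real or CM and `L` neither, `n ≥ 1`, `π` cuspidal regular algebraic on
`GL_n(𝔸_L)` and `P` cuspidal on `GL_{dn}(𝔸_K)` automorphically induced from `π`: `P` is not
regular algebraic.  (So hypotheses "`AI_{L/K}(π)` regular algebraic" in descents of Galois
representations from CM fields are vacuous unless `L` itself is totally real or CM.)  This is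
Patrikis 2019, Rem. 2.4.8, second bullet (arXiv:1207.6724, Rem. 3.2.4: "Suppose that
`π = Ind_L^F(π₀)` … Then `L` is CM"), here from Clozel's theorem by purity of the conjugates. -/
theorem not_isRegularAlgebraic_of_isAutomorphicInductionAlong (h : Clozel1990_regularAlgebraic)
    (hH : Henniart2012_infinityType_of_automorphicInduction) [IsGalois K L]
    (hcyc : IsCyclic (L ≃ₐ[K] L)) (hK : IsTotallyReal K ∨ IsCMField K)
    (hL : ¬ (IsTotallyReal L ∨ IsCMField L)) (n d : ℕ) (hn : 0 < n) (hd : Module.finrank K L = d)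
    (hKc : isCompact_glFiniteIntegralLevel (d * n) K) (hLc : isCompact_glFiniteIntegralLevel n L)
    (P : CuspidalAutomorphicRepData (d * n) K hKc) (π : CuspidalAutomorphicRepData n L hLc)
    (hAI : IsAutomorphicInductionAlong π.1 P.1) (hπ : π.1.IsRegularAlgebraic) :
    ¬ P.1.IsRegularAlgebraic := by
  rintro ⟨TP, hTP, hregP⟩
  obtain ⟨Tπ, hTπ, _⟩ := id hπ
  have hind := hH.hasInfinityType_automorphicInduction K L hcyc n d hn hd hKc hLc P π hAI hTP hTπ
  have e := P.1.hasArchParameter_unique hTP.2 hind.2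
  have hreg : (Tπ.automorphicInduction K (d * n)).IsRegular := by
    intro σ
    have hσ := hregP.2 σ
    rw [show (TP σ).map ArchWeight.a = (Tπ.automorphicInduction K (d * n) σ).map ArchWeight.a from
      congr_fun e σ] at hσ
    exact hσ
  exact not_isRegular_automorphicInduction h hK hL (Nat.pos_iff_ne_zero.mp hn) π hπ hTπ hreg

end Main

end SoloBlind
end Summit.Langlands.Langlands.Theorems
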